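import Literature.NumberTheory.LFunctions.HalaszIntegration
import Literature.NumberTheory.LFunctions.GranvilleSoundararajanPrimeMeanSquare
import Literature.NumberTheory.LFunctions.GranvilleSoundararajanSmoothLogSums
import Literature.NumberTheory.LFunctions.GranvilleSoundararajanDecomposition
import HarnessLib

/-!
# Granville–Soundararajan 2003, Lemma 3.2 with the sharp constant, multiplicative case

Sixth file of the proof of Theorem 1 of Granville–Soundararajan (sharp Halász).  For a
multiplicative `1`-bounded `f`, `x ≥ 3`, `N = ⌊x⌋`, `0 < α ≤ 1`, `T ≥ 1` and a bound
`|F(1+α+iy)| ≤ B` on the window `|y| ≤ T` (`F(s) = ∑ f̃(n) n^{-s}`), we bound the weighted mean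
square `J(α) = ∫_ℝ |A(e^u)|² e^{-2(1+α)u} du` of `A(y) = ∑_{n ≤ y} f̃(n) log n` and deduce the
Cauchy–Schwarz consequence ((3.8) of the paper) in the SHARP form
`∫_{log 2}^{log x} |A(e^u)| e^{-(1+2α)u} du ≤ B · (1 - x^{-2α})/(2α) + O(B + √(m/α) + √m/√T + m²/T)`,
`m = min(log x, 1/α)`, which is what the proof of Theorem 1 integrates in `α` (§4 of the paper).
Ingredients: Mellin–Plancherel (tree), the decomposition `D_f = P_g F + G E_h` on the line
(`GranvilleSoundararajanDecomposition`), the sharp `Λ`-mean square `(1-x^{-2α})/(2α) + O(1)` and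
the `G`-mean square `π/α` (`GranvilleSoundararajanPrimeMeanSquare`), combined on the window by the
Minkowski inequality in the form `‖u+v‖² ≤ (1+ε)‖u‖² + (1+1/ε)‖v‖²` optimised in `ε`; and for the
tails `|y| > T` the mean value theorem for Dirichlet series on blocks of length `T`
(`DirichletMVTSharp`) with `∑ |c_n|² ≪ 1` and `∑ n|c_n|² ≪ m³` (`GranvilleSoundararajanSmoothLogSums`
and the tree), giving `≪ 1/T + m³/T²` as in (3.11).

## Main results
- `setIntegral_Ioi_tail_le_T`, `setIntegral_Iio_tail_le_T` : the `T`-block tails (3.11).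
- `le_sq_sqrt_add_of_forall_eps` : the `ε`-form of Minkowski.
- `exists_inner_integral_le_sharp` : the displayed sharp form of (3.8) + Lemma 3.2.

## References
- [GranvilleSoundararajan2003] A. Granville, K. Soundararajan, *Decay of mean values of
  multiplicative functions*, Canad. J. Math. 55 (2003), §3b, (3.8)–(3.14) and Lemma 3.2,
  arXiv math/9911246 pp. 7–8.
- [MontgomeryVaughan1974] H. L. Montgomery, R. C. Vaughan, *Hilbert's inequality*, Cor. 3.
-/

noncomputable section

open Finset Real Complex MeasureTheory Set Filter

namespace Literature.NumberTheory.LFunctions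

namespace GranvilleSoundararajan

open Halasz (smoothCut mulLog mulVM smoothCut_of_mem smoothCut_of_not_mem norm_smoothCut_le)
open MellinPlancherel (psum)

variable {g : ℕ → ℂ} {N : ℕ}

/-! ### The coefficient sums `∑ |c_n|²` -/

/-- `∑ |c_n|² ≤ 16 ∑ n^{-3/2}` for `c_n = g̃(n) log n / n^{1+α}` (`α > 0`, `|g| ≤ 1`): termwise
`|c_n| ≤ log n / n ≤ 4 n^{-3/4}`. [folklore] -/
theorem tsum_norm_term_mulLog_sq_le (hgb : ∀ n, ‖g n‖ ≤ 1) {α : ℝ} (hα : 0 < α) :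
    Summable (fun n : ℕ => ‖LSeries.term (mulLog g N) (1 + α) n‖ ^ 2) ∧
      ∑' n : ℕ, ‖LSeries.term (mulLog g N) (1 + α) n‖ ^ 2 ≤ 16 * ∑' n : ℕ, ((n : ℝ) ^ (3 / 2 : ℝ))⁻¹ := by
  have hsum : Summable (fun n : ℕ => ((n : ℝ) ^ (3 / 2 : ℝ))⁻¹) :=
    Real.summable_nat_rpow_inv.mpr (by norm_num)
  have hle : ∀ n : ℕ, ‖LSeries.term (mulLog g N) (1 + α) n‖ ^ 2 ≤ 16 * ((n : ℝ) ^ (3 / 2 : ℝ))⁻¹ := by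
    intro n
    rcases Nat.eq_zero_or_pos n with rfl | hn
    · simp
    have hn0 : (0 : ℝ) < n := by exact_mod_cast hn
    have hn1 : (1 : ℝ) ≤ n := by exact_mod_cast hn
    have hterm : ‖LSeries.term (mulLog g N) (1 + α) n‖ ≤ 4 * (n : ℝ) ^ (-(3 / 4) : ℝ) := by
      rw [LSeries.term_of_ne_zero hn.ne', norm_div, Complex.norm_natCast_cpow_of_pos hn]
      simp only [Complex.add_re, Complex.one_re, Complex.ofReal_re]
      have h1 : ‖mulLog g N n‖ ≤ Real.log n := Halasz.norm_mulLog_le hgb n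
      have h2 : Real.log n ≤ 4 * (n : ℝ) ^ (1 / 4 : ℝ) := by
        have := Real.log_le_rpow_div (Nat.cast_nonneg n) (by norm_num : (0 : ℝ) < 1 / 4)
        linarith
      have h3 : (n : ℝ) ≤ (n : ℝ) ^ (1 + α) := by
        calc (n : ℝ) = (n : ℝ) ^ (1 : ℝ) := (Real.rpow_one _).symm
          _ ≤ (n : ℝ) ^ (1 + α) := Real.rpow_le_rpow_of_exponent_le hn1 (by linarith)
      calc ‖mulLog g N n‖ / (n : ℝ) ^ (1 + α) ≤ (4 * (n : ℝ) ^ (1 / 4 : ℝ)) / n := by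
            gcongr; exact h1.trans h2
        _ = 4 * (n : ℝ) ^ (-(3 / 4) : ℝ) := by
            rw [mul_div_assoc, div_eq_mul_inv, ← Real.rpow_neg_one, ← Real.rpow_add hn0]; norm_num
    have hsq : ((n : ℝ) ^ (-(3 / 4) : ℝ)) ^ 2 = ((n : ℝ) ^ (3 / 2 : ℝ))⁻¹ := by
      rw [← Real.rpow_two, ← Real.rpow_mul hn0.le, ← Real.rpow_neg hn0.le]; norm_num
    calc ‖LSeries.term (mulLog g N) (1 + α) n‖ ^ 2 ≤ (4 * (n : ℝ) ^ (-(3 / 4) : ℝ)) ^ 2 :=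
          pow_le_pow_left₀ (norm_nonneg _) hterm 2
      _ = 16 * ((n : ℝ) ^ (3 / 2 : ℝ))⁻¹ := by rw [mul_pow, hsq]; norm_num
  have hs : Summable (fun n : ℕ => ‖LSeries.term (mulLog g N) (1 + α) n‖ ^ 2) :=
    Summable.of_nonneg_of_le (fun n => sq_nonneg _) hle (hsum.mul_left 16)
  refine ⟨hs, ?_⟩
  calc ∑' n : ℕ, ‖LSeries.term (mulLog g N) (1 + α) n‖ ^ 2 ≤ ∑' n : ℕ, 16 * ((n : ℝ) ^ (3 / 2 : ℝ))⁻¹ :=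
        hs.tsum_le_tsum hle (hsum.mul_left 16)
    _ = 16 * ∑' n : ℕ, ((n : ℝ) ^ (3 / 2 : ℝ))⁻¹ := tsum_mul_left

/-! ### Blocks of length `2W` and the tails `|y| > T` -/

/-- **One block** (Montgomery–Vaughan's mean value theorem, sharp in the length):
`∫_{Y-W}^{Y+W} |D(1+α+it)|² dt ≤ (5W + 20) ∑|c_n|² + 65 ∑ n|c_n|²`.
[cite: MontgomeryVaughan1974, Corollary 3] -/
theorem integral_block_le (hgb : ∀ n, ‖g n‖ ≤ 1) {α : ℝ} (hα : 0 < α) {W : ℝ} (hW : 0 < W) (Y : ℝ)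
    {R₀ R₁ : ℝ} (hR₀ : ∑' n : ℕ, ‖LSeries.term (mulLog g N) (1 + α) n‖ ^ 2 ≤ R₀)
    (hs₁ : Summable fun n : ℕ => (n : ℝ) * ‖LSeries.term (mulLog g N) (1 + α) n‖ ^ 2)
    (hR₁ : ∑' n : ℕ, (n : ℝ) * ‖LSeries.term (mulLog g N) (1 + α) n‖ ^ 2 ≤ R₁) :
    ∫ t in (Y - W)..(Y + W), ‖LSeries (mulLog g N) (1 + α + t * I)‖ ^ 2 ≤ (5 * W + 20) * R₀ + 65 * R₁ := by
  set c : ℕ → ℂ := fun n => LSeries.term (mulLog g N) (1 + α) n with hc_def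
  have hc : Summable fun n => ‖c n‖ :=
    (Halasz.LSeriesSummable_mulLog (g := g) (N := N) hgb (s := 1 + α) (by simp; linarith)).norm
  obtain ⟨hs₀, -⟩ := tsum_norm_term_mulLog_sq_le (N := N) hgb hα
  have h0 : c 0 = 0 := LSeries.term_zero _ _
  have hmvt := DirichletMVT.meanSquare_tsum_shift_le hc hs₁ h0 hW Y
  have hint : ∫ t in (Y - W)..(Y + W), ‖LSeries (mulLog g N) (1 + α + t * I)‖ ^ 2 =
      ∫ t in (Y - W)..(Y + W), ‖∑' n : ℕ, c n * (n : ℂ) ^ (-((t : ℂ) * I))‖ ^ 2 := by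
    refine intervalIntegral.integral_congr fun t _ => ?_
    simp only [hc_def, Halasz.LSeries_mulLog_line_eq_tsum]
  rw [hint]
  refine hmvt.trans ?_
  have hsplit : ∀ n : ℕ, (5 * W + 20 + 65 * (n : ℝ)) * ‖c n‖ ^ 2 =
      (5 * W + 20) * ‖c n‖ ^ 2 + 65 * ((n : ℝ) * ‖c n‖ ^ 2) := fun n => by ring
  simp_rw [hsplit]
  rw [(hs₀.mul_left _).tsum_add (hs₁.mul_left _), tsum_mul_left, tsum_mul_left]
  have hW0 : 0 ≤ 5 * W + 20 := by linarith
  nlinarith [mul_le_mul_of_nonneg_left hR₀ hW0]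

/-- `∑_{k < n} 1/(k+1)² ≤ 2`. [folklore] -/
theorem sum_range_inv_succ_sq_le (n : ℕ) : ∑ k ∈ Finset.range n, 1 / ((k : ℝ) + 1) ^ 2 ≤ 2 := by
  rcases Nat.eq_zero_or_pos n with rfl | hn
  · simp
  suffices h : ∑ k ∈ Finset.range n, 1 / ((k : ℝ) + 1) ^ 2 ≤ 2 - 1 / (n : ℝ) by
    have : (0 : ℝ) ≤ 1 / (n : ℝ) := by positivity
    linarith
  induction n, hn using Nat.le_induction with
  | base => norm_num [Finset.sum_range_succ]
  | succ m hm ih =>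
      rw [Finset.sum_range_succ]
      have hm0 : (0 : ℝ) < m := by exact_mod_cast hm
      have hstep : 1 / ((m : ℝ) + 1) ^ 2 ≤ 1 / (m : ℝ) - 1 / ((m : ℝ) + 1) := by
        rw [div_sub_div _ _ hm0.ne' (by positivity), div_le_div_iff₀ (by positivity) (by positivity)]
        nlinarith
      push_cast
      linarith

/-- A block `(a, a + T]` with `a ≥ 0`: `∫_{(a, a+T]} |D|²/|s|² ≤ Q/(1 + a²)`,
`Q = (5T/2 + 20) R₀ + 65 R₁`. [folklore] -/
theorem setIntegral_Ioc_Tblock_le (hgb : ∀ n, ‖g n‖ ≤ 1) {α : ℝ} (hα : 0 < α) {T : ℝ} (hT : 0 < T)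
    {R₀ R₁ : ℝ} (hR₀ : ∑' n : ℕ, ‖LSeries.term (mulLog g N) (1 + α) n‖ ^ 2 ≤ R₀)
    (hs₁ : Summable fun n : ℕ => (n : ℝ) * ‖LSeries.term (mulLog g N) (1 + α) n‖ ^ 2)
    (hR₁ : ∑' n : ℕ, (n : ℝ) * ‖LSeries.term (mulLog g N) (1 + α) n‖ ^ 2 ≤ R₁) {a : ℝ} (ha : 0 ≤ a) :
    ∫ y in Set.Ioc a (a + T), ‖LSeries (mulLog g N) (1 + α + y * I)‖ ^ 2 / ‖(1 : ℂ) + α + y * I‖ ^ 2 ≤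
      ((5 * (T / 2) + 20) * R₀ + 65 * R₁) / (1 + a ^ 2) := by
  have hint := Halasz.integrable_normSq_mulLog_div (N := N) hgb hα
  have hcont := Halasz.continuous_norm_LSeries_mulLog_sq (N := N) hgb hα
  have hpos : 0 < 1 + a ^ 2 := by positivity
  calc ∫ y in Set.Ioc a (a + T), ‖LSeries (mulLog g N) (1 + α + y * I)‖ ^ 2 / ‖(1 : ℂ) + α + y * I‖ ^ 2
      ≤ ∫ y in Set.Ioc a (a + T), ‖LSeries (mulLog g N) (1 + α + y * I)‖ ^ 2 / (1 + a ^ 2) := by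
        refine setIntegral_mono_on hint.integrableOn ?_ measurableSet_Ioc fun y hy => ?_
        · exact (hcont.div_const _).integrableOn_Icc.mono_set Set.Ioc_subset_Icc_self
        · exact Halasz.normSq_div_le_of_le_abs hα.le ha
            (by rw [abs_of_nonneg (ha.trans hy.1.le)]; exact hy.1.le)
    _ = (∫ y in a..(a + T), ‖LSeries (mulLog g N) (1 + α + y * I)‖ ^ 2) / (1 + a ^ 2) := by
        rw [intervalIntegral.integral_of_le (by linarith), integral_div]
    _ ≤ ((5 * (T / 2) + 20) * R₀ + 65 * R₁) / (1 + a ^ 2) := by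
        gcongr
        have h := integral_block_le (N := N) hgb hα (W := T / 2) (by positivity) (a + T / 2) hR₀ hs₁ hR₁
        rwa [show a + T / 2 - T / 2 = a by ring, show a + T / 2 + T / 2 = a + T by ring] at h

/-- A block `[-(a+T), -a)` with `a ≥ 0`: `∫ ≤ Q/(1 + a²)`. [folklore] -/
theorem setIntegral_Ico_Tblock_le (hgb : ∀ n, ‖g n‖ ≤ 1) {α : ℝ} (hα : 0 < α) {T : ℝ} (hT : 0 < T)
    {R₀ R₁ : ℝ} (hR₀ : ∑' n : ℕ, ‖LSeries.term (mulLog g N) (1 + α) n‖ ^ 2 ≤ R₀)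
    (hs₁ : Summable fun n : ℕ => (n : ℝ) * ‖LSeries.term (mulLog g N) (1 + α) n‖ ^ 2)
    (hR₁ : ∑' n : ℕ, (n : ℝ) * ‖LSeries.term (mulLog g N) (1 + α) n‖ ^ 2 ≤ R₁) {a : ℝ} (ha : 0 ≤ a) :
    ∫ y in Set.Ico (-(a + T)) (-a), ‖LSeries (mulLog g N) (1 + α + y * I)‖ ^ 2 / ‖(1 : ℂ) + α + y * I‖ ^ 2 ≤
      ((5 * (T / 2) + 20) * R₀ + 65 * R₁) / (1 + a ^ 2) := by
  have hint := Halasz.integrable_normSq_mulLog_div (N := N) hgb hα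
  have hcont := Halasz.continuous_norm_LSeries_mulLog_sq (N := N) hgb hα
  have hpos : 0 < 1 + a ^ 2 := by positivity
  calc ∫ y in Set.Ico (-(a + T)) (-a), ‖LSeries (mulLog g N) (1 + α + y * I)‖ ^ 2 / ‖(1 : ℂ) + α + y * I‖ ^ 2
      ≤ ∫ y in Set.Ico (-(a + T)) (-a), ‖LSeries (mulLog g N) (1 + α + y * I)‖ ^ 2 / (1 + a ^ 2) := by
        refine setIntegral_mono_on hint.integrableOn ?_ measurableSet_Ico fun y hy => ?_
        · exact (hcont.div_const _).integrableOn_Icc.mono_set Set.Ico_subset_Icc_self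
        · refine Halasz.normSq_div_le_of_le_abs hα.le ha ?_
          have : y < -a := hy.2
          rw [abs_of_neg (by linarith)]
          linarith
    _ = (∫ y in (-(a + T))..(-a), ‖LSeries (mulLog g N) (1 + α + y * I)‖ ^ 2) / (1 + a ^ 2) := by
        rw [intervalIntegral.integral_of_le (by linarith), integral_Ico_eq_integral_Ioc, integral_div]
    _ ≤ ((5 * (T / 2) + 20) * R₀ + 65 * R₁) / (1 + a ^ 2) := by
        gcongr
        have h := integral_block_le (N := N) hgb hα (W := T / 2) (by positivity) (-(a + T / 2)) hR₀ hs₁ hR₁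
        rwa [show -(a + T / 2) - T / 2 = -(a + T) by ring, show -(a + T / 2) + T / 2 = -a by ring] at h

/-- **The right tail on `T`-blocks** (GS03 (3.11)): for `T > 0`,
`∫_{y > T} |D|²/|s|² ≤ 2Q/T²`, `Q = (5T/2 + 20) ∑|c_n|² + 65 ∑ n|c_n|²`.
[cite: GranvilleSoundararajan2003, (3.11)] -/
theorem setIntegral_Ioi_tail_le_T (hgb : ∀ n, ‖g n‖ ≤ 1) {α : ℝ} (hα : 0 < α) {T : ℝ} (hT : 0 < T)
    {R₀ R₁ : ℝ} (hR₀ : ∑' n : ℕ, ‖LSeries.term (mulLog g N) (1 + α) n‖ ^ 2 ≤ R₀)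
    (hs₁ : Summable fun n : ℕ => (n : ℝ) * ‖LSeries.term (mulLog g N) (1 + α) n‖ ^ 2)
    (hR₁ : ∑' n : ℕ, (n : ℝ) * ‖LSeries.term (mulLog g N) (1 + α) n‖ ^ 2 ≤ R₁) :
    ∫ y in Set.Ioi T, ‖LSeries (mulLog g N) (1 + α + y * I)‖ ^ 2 / ‖(1 : ℂ) + α + y * I‖ ^ 2 ≤
      2 * ((5 * (T / 2) + 20) * R₀ + 65 * R₁) / T ^ 2 := by
  set Q : ℝ := (5 * (T / 2) + 20) * R₀ + 65 * R₁ with hQ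
  have hR₀0 : 0 ≤ R₀ := le_trans (tsum_nonneg fun n => sq_nonneg _) hR₀
  have hR₁0 : 0 ≤ R₁ := le_trans (tsum_nonneg fun n => by positivity) hR₁
  have hQ0 : 0 ≤ Q := by positivity
  set S : ℕ → Set ℝ := fun k => Set.Ioc (T * ((k : ℝ) + 1)) (T * ((k : ℝ) + 1) + T) with hS
  have hSm : ∀ k, MeasurableSet (S k) := fun k => measurableSet_Ioc
  have hSd : Pairwise (Function.onFun Disjoint S) := by
    intro k l hkl
    rcases lt_or_gt_of_ne hkl with h | h
    · refine Set.disjoint_left.2 fun y hy hy' => ?_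
      have : (k : ℝ) + 1 ≤ l := by exact_mod_cast h
      simp only [hS, Set.mem_Ioc] at hy hy'
      nlinarith
    · refine Set.disjoint_left.2 fun y hy hy' => ?_
      have : (l : ℝ) + 1 ≤ k := by exact_mod_cast h
      simp only [hS, Set.mem_Ioc] at hy hy'
      nlinarith
  have hSU : (⋃ k, S k) = Set.Ioi T := by
    ext y
    simp only [Set.mem_iUnion, hS, Set.mem_Ioc, Set.mem_Ioi]
    constructor
    · rintro ⟨k, hk, -⟩
      have : (0 : ℝ) ≤ k := Nat.cast_nonneg k
      nlinarith
    · intro hy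
      set z : ℝ := y / T - 1 with hz
      have hz0 : 0 < z := by rw [hz, sub_pos, one_lt_div hT]; exact hy
      have hyT : y = T * (z + 1) := by rw [hz]; field_simp; ring
      refine ⟨⌈z⌉₊ - 1, ?_, ?_⟩
      · have h1 : (1 : ℕ) ≤ ⌈z⌉₊ := Nat.one_le_iff_ne_zero.2 (by
          rw [Ne, Nat.ceil_eq_zero]; linarith)
        rw [Nat.cast_sub h1, Nat.cast_one, hyT]
        have := Nat.ceil_lt_add_one hz0.le
        nlinarith
      · have h1 : (1 : ℕ) ≤ ⌈z⌉₊ := Nat.one_le_iff_ne_zero.2 (by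
          rw [Ne, Nat.ceil_eq_zero]; linarith)
        rw [Nat.cast_sub h1, Nat.cast_one, hyT]
        have := Nat.le_ceil z
        nlinarith
  have hint := Halasz.integrable_normSq_mulLog_div (N := N) hgb hα
  have hsum := hasSum_integral_iUnion (μ := volume)
    (f := (fun y : ℝ => ‖LSeries (mulLog g N) (1 + α + y * I)‖ ^ 2 / ‖(1 : ℂ) + α + y * I‖ ^ 2)) hSm hSd
    hint.integrableOn
  rw [hSU] at hsum
  have hb : ∀ k : ℕ, ∫ y in S k, ‖LSeries (mulLog g N) (1 + α + y * I)‖ ^ 2 / ‖(1 : ℂ) + α + y * I‖ ^ 2 ≤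
      Q / T ^ 2 * (1 / ((k : ℝ) + 1) ^ 2) := by
    intro k
    have hk : (0 : ℝ) ≤ k := Nat.cast_nonneg k
    have ha : (0 : ℝ) ≤ T * ((k : ℝ) + 1) := by positivity
    have h := setIntegral_Ioc_Tblock_le (N := N) hgb hα hT hR₀ hs₁ hR₁ ha
    refine h.trans ?_
    rw [div_mul_div_comm, mul_one, div_le_div_iff₀ (by positivity) (by positivity)]
    nlinarith [sq_nonneg (T * ((k : ℝ) + 1))]
  have hbsum : Summable fun k : ℕ => Q / T ^ 2 * (1 / ((k : ℝ) + 1) ^ 2) := by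
    refine summable_of_sum_range_le (c := Q / T ^ 2 * 2) (fun k => by positivity) fun n => ?_
    rw [← Finset.mul_sum]
    exact mul_le_mul_of_nonneg_left (sum_range_inv_succ_sq_le n) (by positivity)
  have htsum : ∑' k : ℕ, Q / T ^ 2 * (1 / ((k : ℝ) + 1) ^ 2) ≤ Q / T ^ 2 * 2 := by
    refine Real.tsum_le_of_sum_range_le (fun k => by positivity) fun n => ?_
    rw [← Finset.mul_sum]
    exact mul_le_mul_of_nonneg_left (sum_range_inv_succ_sq_le n) (by positivity)
  calc ∫ y in Set.Ioi T, ‖LSeries (mulLog g N) (1 + α + y * I)‖ ^ 2 / ‖(1 : ℂ) + α + y * I‖ ^ 2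
      = ∑' k : ℕ, ∫ y in S k, ‖LSeries (mulLog g N) (1 + α + y * I)‖ ^ 2 / ‖(1 : ℂ) + α + y * I‖ ^ 2 :=
        hsum.tsum_eq.symm
    _ ≤ ∑' k : ℕ, Q / T ^ 2 * (1 / ((k : ℝ) + 1) ^ 2) := hsum.summable.tsum_le_tsum hb hbsum
    _ ≤ Q / T ^ 2 * 2 := htsum
    _ = 2 * Q / T ^ 2 := by ring

/-- **The left tail on `T`-blocks**: `∫_{y < -T} |D|²/|s|² ≤ 2Q/T²`. [cite: GranvilleSoundararajan2003, (3.11)] -/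
theorem setIntegral_Iio_tail_le_T (hgb : ∀ n, ‖g n‖ ≤ 1) {α : ℝ} (hα : 0 < α) {T : ℝ} (hT : 0 < T)
    {R₀ R₁ : ℝ} (hR₀ : ∑' n : ℕ, ‖LSeries.term (mulLog g N) (1 + α) n‖ ^ 2 ≤ R₀)
    (hs₁ : Summable fun n : ℕ => (n : ℝ) * ‖LSeries.term (mulLog g N) (1 + α) n‖ ^ 2)
    (hR₁ : ∑' n : ℕ, (n : ℝ) * ‖LSeries.term (mulLog g N) (1 + α) n‖ ^ 2 ≤ R₁) :
    ∫ y in Set.Iio (-T), ‖LSeries (mulLog g N) (1 + α + y * I)‖ ^ 2 / ‖(1 : ℂ) + α + y * I‖ ^ 2 ≤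
      2 * ((5 * (T / 2) + 20) * R₀ + 65 * R₁) / T ^ 2 := by
  set Q : ℝ := (5 * (T / 2) + 20) * R₀ + 65 * R₁ with hQ
  have hR₀0 : 0 ≤ R₀ := le_trans (tsum_nonneg fun n => sq_nonneg _) hR₀
  have hR₁0 : 0 ≤ R₁ := le_trans (tsum_nonneg fun n => by positivity) hR₁
  have hQ0 : 0 ≤ Q := by positivity
  set S : ℕ → Set ℝ := fun k => Set.Ico (-(T * ((k : ℝ) + 1) + T)) (-(T * ((k : ℝ) + 1))) with hS
  have hSm : ∀ k, MeasurableSet (S k) := fun k => measurableSet_Ico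
  have hSd : Pairwise (Function.onFun Disjoint S) := by
    intro k l hkl
    rcases lt_or_gt_of_ne hkl with h | h
    · refine Set.disjoint_left.2 fun y hy hy' => ?_
      have : (k : ℝ) + 1 ≤ l := by exact_mod_cast h
      simp only [hS, Set.mem_Ico] at hy hy'
      nlinarith
    · refine Set.disjoint_left.2 fun y hy hy' => ?_
      have : (l : ℝ) + 1 ≤ k := by exact_mod_cast h
      simp only [hS, Set.mem_Ico] at hy hy'
      nlinarith
  have hSU : (⋃ k, S k) = Set.Iio (-T) := by
    ext y
    simp only [Set.mem_iUnion, hS, Set.mem_Ico, Set.mem_Iio]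
    constructor
    · rintro ⟨k, -, hk⟩
      have : (0 : ℝ) ≤ k := Nat.cast_nonneg k
      nlinarith
    · intro hy
      set z : ℝ := -y / T - 1 with hz
      have hz0 : 0 < z := by rw [hz, sub_pos, one_lt_div hT]; linarith
      have hyT : y = -(T * (z + 1)) := by rw [hz]; field_simp; ring
      refine ⟨⌈z⌉₊ - 1, ?_, ?_⟩
      · have h1 : (1 : ℕ) ≤ ⌈z⌉₊ := Nat.one_le_iff_ne_zero.2 (by
          rw [Ne, Nat.ceil_eq_zero]; linarith)
        rw [Nat.cast_sub h1, Nat.cast_one, hyT]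
        have := Nat.le_ceil z
        nlinarith
      · have h1 : (1 : ℕ) ≤ ⌈z⌉₊ := Nat.one_le_iff_ne_zero.2 (by
          rw [Ne, Nat.ceil_eq_zero]; linarith)
        rw [Nat.cast_sub h1, Nat.cast_one, hyT]
        have := Nat.ceil_lt_add_one hz0.le
        nlinarith
  have hint := Halasz.integrable_normSq_mulLog_div (N := N) hgb hα
  have hsum := hasSum_integral_iUnion (μ := volume)
    (f := (fun y : ℝ => ‖LSeries (mulLog g N) (1 + α + y * I)‖ ^ 2 / ‖(1 : ℂ) + α + y * I‖ ^ 2)) hSm hSd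
    hint.integrableOn
  rw [hSU] at hsum
  have hb : ∀ k : ℕ, ∫ y in S k, ‖LSeries (mulLog g N) (1 + α + y * I)‖ ^ 2 / ‖(1 : ℂ) + α + y * I‖ ^ 2 ≤
      Q / T ^ 2 * (1 / ((k : ℝ) + 1) ^ 2) := by
    intro k
    have hk : (0 : ℝ) ≤ k := Nat.cast_nonneg k
    have ha : (0 : ℝ) ≤ T * ((k : ℝ) + 1) := by positivity
    have h := setIntegral_Ico_Tblock_le (N := N) hgb hα hT hR₀ hs₁ hR₁ ha
    refine h.trans ?_
    rw [div_mul_div_comm, mul_one, div_le_div_iff₀ (by positivity) (by positivity)]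
    nlinarith [sq_nonneg (T * ((k : ℝ) + 1))]
  have hbsum : Summable fun k : ℕ => Q / T ^ 2 * (1 / ((k : ℝ) + 1) ^ 2) := by
    refine summable_of_sum_range_le (c := Q / T ^ 2 * 2) (fun k => by positivity) fun n => ?_
    rw [← Finset.mul_sum]
    exact mul_le_mul_of_nonneg_left (sum_range_inv_succ_sq_le n) (by positivity)
  have htsum : ∑' k : ℕ, Q / T ^ 2 * (1 / ((k : ℝ) + 1) ^ 2) ≤ Q / T ^ 2 * 2 := by
    refine Real.tsum_le_of_sum_range_le (fun k => by positivity) fun n => ?_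
    rw [← Finset.mul_sum]
    exact mul_le_mul_of_nonneg_left (sum_range_inv_succ_sq_le n) (by positivity)
  calc ∫ y in Set.Iio (-T), ‖LSeries (mulLog g N) (1 + α + y * I)‖ ^ 2 / ‖(1 : ℂ) + α + y * I‖ ^ 2
      = ∑' k : ℕ, ∫ y in S k, ‖LSeries (mulLog g N) (1 + α + y * I)‖ ^ 2 / ‖(1 : ℂ) + α + y * I‖ ^ 2 :=
        hsum.tsum_eq.symm
    _ ≤ ∑' k : ℕ, Q / T ^ 2 * (1 / ((k : ℝ) + 1) ^ 2) := hsum.summable.tsum_le_tsum hb hbsum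
    _ ≤ Q / T ^ 2 * 2 := htsum
    _ = 2 * Q / T ^ 2 := by ring

/-! ### Elementary inequalities -/

/-- `‖u + v‖² ≤ (1+ε)‖u‖² + (1+1/ε)‖v‖²` for `ε > 0`. [folklore] -/
theorem norm_add_sq_le_eps (u v : ℂ) {ε : ℝ} (hε : 0 < ε) :
    ‖u + v‖ ^ 2 ≤ (1 + ε) * ‖u‖ ^ 2 + (1 + ε⁻¹) * ‖v‖ ^ 2 := by
  have h1 : ‖u + v‖ ^ 2 ≤ (‖u‖ + ‖v‖) ^ 2 := pow_le_pow_left₀ (norm_nonneg _) (norm_add_le u v) 2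
  have key : 2 * ‖u‖ * ‖v‖ ≤ ε * ‖u‖ ^ 2 + ε⁻¹ * ‖v‖ ^ 2 := by
    have h0 : 0 ≤ (ε * ‖u‖ - ‖v‖) ^ 2 / ε := by positivity
    have hid : ε * ‖u‖ ^ 2 + ε⁻¹ * ‖v‖ ^ 2 - 2 * ‖u‖ * ‖v‖ = (ε * ‖u‖ - ‖v‖) ^ 2 / ε := by
      field_simp; ring
    linarith
  nlinarith

/-- `√K √(K + C) ≤ K + C/2` for `K, C ≥ 0`. [folklore] -/
theorem sqrt_mul_sqrt_add_le {K C : ℝ} (hK : 0 ≤ K) (hC : 0 ≤ C) :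
    Real.sqrt K * Real.sqrt (K + C) ≤ K + C / 2 := by
  have h1 : Real.sqrt K ^ 2 = K := Real.sq_sqrt hK
  have h2 : Real.sqrt (K + C) ^ 2 = K + C := Real.sq_sqrt (by linarith)
  nlinarith [sq_nonneg (Real.sqrt K - Real.sqrt (K + C)), Real.sqrt_nonneg K, Real.sqrt_nonneg (K + C)]

/-- **Minkowski in `ε`-form**: if `W ≤ (1+ε)A + (1+1/ε)B` for every `ε > 0` (`A, B ≥ 0`), then
`W ≤ (√A + √B)²`. [folklore] -/
theorem le_sq_sqrt_add_of_forall_eps {W A B : ℝ} (hA : 0 ≤ A) (hB : 0 ≤ B)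
    (h : ∀ ε : ℝ, 0 < ε → W ≤ (1 + ε) * A + (1 + ε⁻¹) * B) :
    W ≤ (Real.sqrt A + Real.sqrt B) ^ 2 := by
  have hsq : (Real.sqrt A + Real.sqrt B) ^ 2 = A + B + 2 * (Real.sqrt A * Real.sqrt B) := by
    rw [add_sq, Real.sq_sqrt hA, Real.sq_sqrt hB]; ring
  rw [hsq]
  rcases hA.eq_or_lt with hA0 | hApos
  · -- `A = 0`
    rw [← hA0, Real.sqrt_zero, zero_mul, mul_zero, add_zero, zero_add]
    by_contra hlt
    push Not at hlt
    rcases hB.eq_or_lt with hB0 | hBpos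
    · have := h 1 one_pos
      rw [← hA0, ← hB0] at this
      linarith
    · set ε : ℝ := 2 * B / (W - B) with hε
      have hWB : 0 < W - B := by linarith
      have hε0 : 0 < ε := by positivity
      have := h ε hε0
      have hεB : ε⁻¹ * B = (W - B) / 2 := by
        rw [hε]; field_simp
      rw [← hA0] at this
      linarith
  · rcases hB.eq_or_lt with hB0 | hBpos
    · -- `B = 0`, `A > 0`
      rw [← hB0, Real.sqrt_zero, mul_zero, mul_zero, add_zero, add_zero]
      by_contra hlt
      push Not at hlt
      set ε : ℝ := (W - A) / (2 * A) with hε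
      have hWA : 0 < W - A := by linarith
      have hε0 : 0 < ε := by positivity
      have := h ε hε0
      have hεA : ε * A = (W - A) / 2 := by rw [hε]; field_simp
      rw [← hB0] at this
      linarith
    · set ε : ℝ := Real.sqrt B / Real.sqrt A with hε
      have hsA : 0 < Real.sqrt A := Real.sqrt_pos.mpr hApos
      have hsB : 0 < Real.sqrt B := Real.sqrt_pos.mpr hBpos
      have hε0 : 0 < ε := by positivity
      have := h ε hε0
      have h1 : ε * A = Real.sqrt A * Real.sqrt B := by
        calc ε * A = Real.sqrt B * (A / Real.sqrt A) := by rw [hε]; ring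
          _ = Real.sqrt B * Real.sqrt A := by rw [Real.div_sqrt]
          _ = Real.sqrt A * Real.sqrt B := mul_comm _ _
      have h2 : ε⁻¹ * B = Real.sqrt A * Real.sqrt B := by
        calc ε⁻¹ * B = Real.sqrt A * (B / Real.sqrt B) := by rw [hε, inv_div]; ring
          _ = Real.sqrt A * Real.sqrt B := by rw [Real.div_sqrt]
      linarith

/-- `∫_{(log 2, log x]} e^{-2αu} du ≤ (1 - x^{-2α})/(2α)` (`α > 0`, `x ≥ 3`). [folklore] -/
theorem setIntegral_exp_neg_le_K {x α : ℝ} (hx : 3 ≤ x) (hα : 0 < α) :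
    ∫ u in Set.Ioc (Real.log 2) (Real.log x), Real.exp (-(2 * α) * u) ≤ (1 - x ^ (-(2 * α))) / (2 * α) := by
  have hx0 : 0 < x := by linarith
  have hlx : Real.log 2 ≤ Real.log x := Real.log_le_log (by norm_num) (by linarith)
  rw [← intervalIntegral.integral_of_le hlx,
    intervalIntegral.integral_comp_mul_left (f := Real.exp) (by linarith : -(2 * α) ≠ 0), integral_exp,
    smul_eq_mul]
  have h1 : Real.exp (-(2 * α) * Real.log x) = x ^ (-(2 * α)) := by
    rw [Real.rpow_def_of_pos hx0]; congr 1; ring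
  have h2 : Real.exp (-(2 * α) * Real.log 2) ≤ 1 := by
    rw [Real.exp_le_one_iff]
    have := Real.log_pos (show (1:ℝ) < 2 by norm_num)
    nlinarith
  rw [h1]
  have hα2 : 0 < 2 * α := by positivity
  rw [inv_neg, neg_mul, ← mul_neg, neg_sub, inv_mul_eq_div, div_le_div_iff_of_pos_right hα2]
  linarith

/-! ### The window `|y| ≤ T` for multiplicative `f` -/

/-- **The window, multiplicative case** (GS03 (3.12)–(3.13)): for `1`-bounded multiplicative `f`,
`g = cmLift f`, and `|F(1+α+iy)| ≤ B` on `|y| ≤ T`, for every `ε > 0`,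
`∫_{|y|≤T} |D_f|²/|s|² ≤ (1+ε) B² ∫_ℝ |P_g|²/|s|² + (1+1/ε) (3 cmDefectBound)² ∫_ℝ |G|²/|s|²`.
[cite: GranvilleSoundararajan2003, (3.12)–(3.13)] -/
theorem setIntegral_window_le_eps (f : ArithmeticFunction ℂ) (hf : f.IsMultiplicative)
    (hfb : ∀ n, ‖f n‖ ≤ 1) (N : ℕ) {α : ℝ} (hα : 0 < α) {T B : ℝ}
    (hB : ∀ y : ℝ, |y| ≤ T → ‖LSeries (smoothCut (⇑f) N) (1 + α + y * I)‖ ≤ B) {ε : ℝ} (hε : 0 < ε) :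
    ∫ y in Set.Icc (-T) T, ‖LSeries (mulLog (⇑f) N) (1 + α + y * I)‖ ^ 2 / ‖(1 : ℂ) + α + y * I‖ ^ 2 ≤
      (1 + ε) * B ^ 2 * (∫ y : ℝ, ‖LSeries (mulVM (⇑(cmLift f)) N) (1 + α + y * I)‖ ^ 2 /
          ‖(1 : ℂ) + α + y * I‖ ^ 2) +
        (1 + ε⁻¹) * (3 * cmDefectBound) ^ 2 *
          (∫ y : ℝ, ‖LSeries (smoothCut (⇑(cmLift f)) N) (1 + α + y * I)‖ ^ 2 / ‖(1 : ℂ) + α + y * I‖ ^ 2) := by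
  have hgb : ∀ n, ‖cmLift f n‖ ≤ 1 := norm_cmLift_le_one f (fun p _ => hfb p)
  have hintD := Halasz.integrable_normSq_mulLog_div (g := ⇑f) (N := N) hfb hα
  have hintP : Integrable (fun y : ℝ => ‖LSeries (mulVM (⇑(cmLift f)) N) (1 + α + y * I)‖ ^ 2 /
      ‖(1 : ℂ) + α + y * I‖ ^ 2) := by
    have h := Halasz.integrable_norm_LSeries_sq_div (a := mulVM (⇑(cmLift f)) N) (σ := 1 + α) (by linarith)
      (Halasz.summable_norm_mulVM_div_rpow hgb (by linarith))
    simpa only [Halasz.ofReal_one_add] using h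
  have hintG : Integrable (fun y : ℝ => ‖LSeries (smoothCut (⇑(cmLift f)) N) (1 + α + y * I)‖ ^ 2 /
      ‖(1 : ℂ) + α + y * I‖ ^ 2) := integrable_normSq_smoothCut_div (N := N) hgb hα
  have hP0 : ∀ y : ℝ, 0 ≤ ‖LSeries (mulVM (⇑(cmLift f)) N) (1 + α + y * I)‖ ^ 2 / ‖(1 : ℂ) + α + y * I‖ ^ 2 :=
    fun y => by positivity
  have hG0 : ∀ y : ℝ, 0 ≤ ‖LSeries (smoothCut (⇑(cmLift f)) N) (1 + α + y * I)‖ ^ 2 / ‖(1 : ℂ) + α + y * I‖ ^ 2 :=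
    fun y => by positivity
  set CE : ℝ := 3 * cmDefectBound with hCE
  have hptw : ∀ y ∈ Set.Icc (-T) T, ‖LSeries (mulLog (⇑f) N) (1 + α + y * I)‖ ^ 2 / ‖(1 : ℂ) + α + y * I‖ ^ 2 ≤
      (1 + ε) * B ^ 2 * (‖LSeries (mulVM (⇑(cmLift f)) N) (1 + α + y * I)‖ ^ 2 / ‖(1 : ℂ) + α + y * I‖ ^ 2) +
        (1 + ε⁻¹) * CE ^ 2 *
          (‖LSeries (smoothCut (⇑(cmLift f)) N) (1 + α + y * I)‖ ^ 2 / ‖(1 : ℂ) + α + y * I‖ ^ 2) := by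
    intro y hy
    have hyT : |y| ≤ T := abs_le.2 ⟨by linarith [hy.1], hy.2⟩
    have hre : 1 < ((1 : ℂ) + α + y * I).re := by rw [Halasz.one_add_re]; linarith
    obtain ⟨-, hE⟩ := norm_LSeries_mulLog_cmDefect_le f hf hfb N hre.le
    rw [LSeries_mulLog_eq_add f hf hfb N hre]
    have hB' := hB y hyT
    have hB0 : 0 ≤ B := (norm_nonneg _).trans hB'
    set u := LSeries (mulVM (⇑(cmLift f)) N) (1 + ↑α + ↑y * I) * LSeries (smoothCut (⇑f) N) (1 + ↑α + ↑y * I)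
    set v := LSeries (smoothCut (⇑(cmLift f)) N) (1 + ↑α + ↑y * I) * LSeries (mulLog (⇑(cmDefect f)) N) (1 + ↑α + ↑y * I)
    have h1 := norm_add_sq_le_eps u v hε
    have hu : ‖u‖ ^ 2 ≤ ‖LSeries (mulVM (⇑(cmLift f)) N) (1 + α + y * I)‖ ^ 2 * B ^ 2 := by
      rw [norm_mul, mul_pow]; gcongr
    have hv : ‖v‖ ^ 2 ≤ ‖LSeries (smoothCut (⇑(cmLift f)) N) (1 + α + y * I)‖ ^ 2 * CE ^ 2 := by
      rw [norm_mul, mul_pow]; gcongr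
    have hs0 : 0 < ‖(1 : ℂ) + α + y * I‖ ^ 2 := by
      have : ((1 : ℂ) + α + y * I) ≠ 0 := by
        intro h; have := congrArg Complex.re h; simp at this; linarith
      positivity
    have hε1 : 0 ≤ 1 + ε⁻¹ := by positivity
    calc ‖u + v‖ ^ 2 / ‖(1 : ℂ) + α + y * I‖ ^ 2
        ≤ ((1 + ε) * (‖LSeries (mulVM (⇑(cmLift f)) N) (1 + α + y * I)‖ ^ 2 * B ^ 2) +
            (1 + ε⁻¹) * (‖LSeries (smoothCut (⇑(cmLift f)) N) (1 + α + y * I)‖ ^ 2 * CE ^ 2)) /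
            ‖(1 : ℂ) + α + y * I‖ ^ 2 := by
          refine div_le_div_of_nonneg_right ?_ hs0.le
          nlinarith [mul_le_mul_of_nonneg_left hu (by linarith : (0:ℝ) ≤ 1 + ε),
            mul_le_mul_of_nonneg_left hv hε1]
      _ = (1 + ε) * B ^ 2 * (‖LSeries (mulVM (⇑(cmLift f)) N) (1 + α + y * I)‖ ^ 2 / ‖(1 : ℂ) + α + y * I‖ ^ 2) +
            (1 + ε⁻¹) * CE ^ 2 *
              (‖LSeries (smoothCut (⇑(cmLift f)) N) (1 + α + y * I)‖ ^ 2 / ‖(1 : ℂ) + α + y * I‖ ^ 2) := by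
          field_simp
  have hB2 : 0 ≤ (1 + ε) * B ^ 2 := by positivity
  have hC2 : 0 ≤ (1 + ε⁻¹) * CE ^ 2 := by positivity
  calc ∫ y in Set.Icc (-T) T, ‖LSeries (mulLog (⇑f) N) (1 + α + y * I)‖ ^ 2 / ‖(1 : ℂ) + α + y * I‖ ^ 2
      ≤ ∫ y in Set.Icc (-T) T,
          ((1 + ε) * B ^ 2 * (‖LSeries (mulVM (⇑(cmLift f)) N) (1 + α + y * I)‖ ^ 2 / ‖(1 : ℂ) + α + y * I‖ ^ 2) +
            (1 + ε⁻¹) * CE ^ 2 *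
              (‖LSeries (smoothCut (⇑(cmLift f)) N) (1 + α + y * I)‖ ^ 2 / ‖(1 : ℂ) + α + y * I‖ ^ 2)) :=
        setIntegral_mono_on hintD.integrableOn
          ((hintP.const_mul _).add (hintG.const_mul _)).integrableOn measurableSet_Icc hptw
    _ = (1 + ε) * B ^ 2 * (∫ y in Set.Icc (-T) T,
            ‖LSeries (mulVM (⇑(cmLift f)) N) (1 + α + y * I)‖ ^ 2 / ‖(1 : ℂ) + α + y * I‖ ^ 2) +
          (1 + ε⁻¹) * CE ^ 2 * (∫ y in Set.Icc (-T) T,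
            ‖LSeries (smoothCut (⇑(cmLift f)) N) (1 + α + y * I)‖ ^ 2 / ‖(1 : ℂ) + α + y * I‖ ^ 2) := by
        rw [integral_add (hintP.const_mul _).integrableOn (hintG.const_mul _).integrableOn,
          integral_const_mul, integral_const_mul]
    _ ≤ (1 + ε) * B ^ 2 * (∫ y : ℝ, ‖LSeries (mulVM (⇑(cmLift f)) N) (1 + α + y * I)‖ ^ 2 /
            ‖(1 : ℂ) + α + y * I‖ ^ 2) +
          (1 + ε⁻¹) * CE ^ 2 * (∫ y : ℝ, ‖LSeries (smoothCut (⇑(cmLift f)) N) (1 + α + y * I)‖ ^ 2 /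
            ‖(1 : ℂ) + α + y * I‖ ^ 2) :=
        add_le_add
          (mul_le_mul_of_nonneg_left (setIntegral_le_integral hintP (Filter.Eventually.of_forall hP0)) hB2)
          (mul_le_mul_of_nonneg_left (setIntegral_le_integral hintG (Filter.Eventually.of_forall hG0)) hC2)

/-! ### The final algebra -/

/-- The real-variable bookkeeping of (3.8) + Lemma 3.2: with `𝔄 = B²·2π(K + C₅)`, `𝔅 = C_E² π/α`,
`Q = (5T/2 + 20) R₀ + 65 C_R m³`, `0 ≤ K ≤ m`, `T ≥ 1`,
`√K √((1/2π)((√𝔄 + √𝔅)² + 4Q/T²)) ≤ B K + C (B + √(m/α) + √m/√T + m²/T)`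
with `C = C₅/2 + C_E + √(45 R₀/2) + √(65 C_R) + 1`. [folklore] -/
theorem final_algebra {B K C₅ CE α m T R₀ CR : ℝ} (hB : 0 ≤ B) (hK : 0 ≤ K) (hC₅ : 0 ≤ C₅)
    (hCE : 0 ≤ CE) (hα : 0 < α) (hm : 0 ≤ m) (hKm : K ≤ m) (hT : 1 ≤ T) (hR₀ : 0 ≤ R₀) (hCR : 0 ≤ CR) :
    Real.sqrt K * Real.sqrt ((1 / (2 * π)) *
        ((Real.sqrt (B ^ 2 * (2 * π * (K + C₅))) + Real.sqrt (CE ^ 2 * (π / α))) ^ 2 +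
          4 * ((5 * (T / 2) + 20) * R₀ + 65 * (CR * m ^ 3)) / T ^ 2)) ≤
      B * K + (C₅ / 2 + CE + Real.sqrt (45 / 2 * R₀) + Real.sqrt (65 * CR) + 1) *
        (B + Real.sqrt (m / α) + Real.sqrt m / Real.sqrt T + m ^ 2 / T) := by
  have hπ0 : 0 < π := Real.pi_pos
  have hT0 : 0 < T := by linarith
  -- subadditivity of `√` (cf. `MRT2015.sqrt_add_le_sqrt_add_sqrt`, not in the import closure)
  have sqrt_add_le' : ∀ {a b : ℝ}, 0 ≤ a → 0 ≤ b → Real.sqrt (a + b) ≤ Real.sqrt a + Real.sqrt b := by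
    intro a b ha hb
    rw [Real.sqrt_le_iff]
    refine ⟨by positivity, ?_⟩
    rw [add_sq, Real.sq_sqrt ha, Real.sq_sqrt hb]
    nlinarith [Real.sqrt_nonneg a, Real.sqrt_nonneg b, mul_nonneg (Real.sqrt_nonneg a) (Real.sqrt_nonneg b)]
  have sqrt_four : Real.sqrt 4 = 2 := by
    rw [show (4 : ℝ) = 2 ^ 2 by norm_num, Real.sqrt_sq (by norm_num)]
  set Q : ℝ := (5 * (T / 2) + 20) * R₀ + 65 * (CR * m ^ 3) with hQ
  have hQ0 : 0 ≤ Q := by positivity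
  set sA : ℝ := Real.sqrt (B ^ 2 * (2 * π * (K + C₅))) with hsA
  set sB : ℝ := Real.sqrt (CE ^ 2 * (π / α)) with hsB
  have hsA' : sA = B * Real.sqrt (2 * π * (K + C₅)) := by
    rw [hsA, Real.sqrt_mul (sq_nonneg B), Real.sqrt_sq hB]
  have hsB' : sB = CE * Real.sqrt (π / α) := by
    rw [hsB, Real.sqrt_mul (sq_nonneg CE), Real.sqrt_sq hCE]
  have hsA0 : 0 ≤ sA := Real.sqrt_nonneg _
  have hsB0 : 0 ≤ sB := Real.sqrt_nonneg _
  have hc0 : 0 ≤ 1 / (2 * π) := by positivity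
  -- subadditivity
  have h1 : Real.sqrt ((1 / (2 * π)) * ((sA + sB) ^ 2 + 4 * Q / T ^ 2)) ≤
      Real.sqrt (1 / (2 * π)) * ((sA + sB) + 2 * Real.sqrt Q / T) := by
    rw [Real.sqrt_mul hc0]
    refine mul_le_mul_of_nonneg_left ?_ (Real.sqrt_nonneg _)
    calc Real.sqrt ((sA + sB) ^ 2 + 4 * Q / T ^ 2) ≤ Real.sqrt ((sA + sB) ^ 2) + Real.sqrt (4 * Q / T ^ 2) :=
          sqrt_add_le' (sq_nonneg _) (by positivity)
      _ = (sA + sB) + 2 * Real.sqrt Q / T := by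
          rw [Real.sqrt_sq (by positivity), Real.sqrt_div' _ (sq_nonneg T), Real.sqrt_sq hT0.le,
            Real.sqrt_mul (by norm_num : (0:ℝ) ≤ 4), sqrt_four]
  have hK0' : 0 ≤ Real.sqrt K := Real.sqrt_nonneg K
  -- the three terms
  have hT1 : Real.sqrt K * (Real.sqrt (1 / (2 * π)) * sA) ≤ B * K + C₅ / 2 * B := by
    rw [hsA']
    have hprod : Real.sqrt (1 / (2 * π)) * Real.sqrt (2 * π * (K + C₅)) = Real.sqrt (K + C₅) := by
      rw [← Real.sqrt_mul hc0]; congr 1; field_simp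
    calc Real.sqrt K * (Real.sqrt (1 / (2 * π)) * (B * Real.sqrt (2 * π * (K + C₅))))
        = B * (Real.sqrt K * (Real.sqrt (1 / (2 * π)) * Real.sqrt (2 * π * (K + C₅)))) := by ring
      _ = B * (Real.sqrt K * Real.sqrt (K + C₅)) := by rw [hprod]
      _ ≤ B * (K + C₅ / 2) := mul_le_mul_of_nonneg_left (sqrt_mul_sqrt_add_le hK hC₅) hB
      _ = B * K + C₅ / 2 * B := by ring
  have hT2 : Real.sqrt K * (Real.sqrt (1 / (2 * π)) * sB) ≤ CE * Real.sqrt (m / α) := by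
    rw [hsB']
    have hprod : Real.sqrt K * (Real.sqrt (1 / (2 * π)) * Real.sqrt (π / α)) = Real.sqrt (K / (2 * α)) := by
      rw [← Real.sqrt_mul hc0, ← Real.sqrt_mul hK]; congr 1; field_simp
    have hmono : Real.sqrt (K / (2 * α)) ≤ Real.sqrt (m / α) := by
      apply Real.sqrt_le_sqrt
      rw [div_le_div_iff₀ (by positivity) hα]
      nlinarith
    calc Real.sqrt K * (Real.sqrt (1 / (2 * π)) * (CE * Real.sqrt (π / α)))
        = CE * (Real.sqrt K * (Real.sqrt (1 / (2 * π)) * Real.sqrt (π / α))) := by ring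
      _ = CE * Real.sqrt (K / (2 * α)) := by rw [hprod]
      _ ≤ CE * Real.sqrt (m / α) := mul_le_mul_of_nonneg_left hmono hCE
  have hT3 : Real.sqrt K * (Real.sqrt (1 / (2 * π)) * (2 * Real.sqrt Q / T)) ≤
      Real.sqrt (45 / 2 * R₀) * (Real.sqrt m / Real.sqrt T) + Real.sqrt (65 * CR) * (m ^ 2 / T) := by
    -- `2 √(1/2π) ≤ 1`
    have hc1 : Real.sqrt (1 / (2 * π)) * 2 ≤ 1 := by
      have : Real.sqrt (1 / (2 * π)) ≤ 1 / 2 := by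
        rw [Real.sqrt_le_iff]
        refine ⟨by norm_num, ?_⟩
        rw [div_le_iff₀ (by positivity)]
        nlinarith [Real.pi_gt_three]
      linarith
    -- `√Q ≤ √(45/2 R₀) √T + √(65 CR) √(m³)`
    have hQle : Q ≤ 45 / 2 * R₀ * T + 65 * CR * m ^ 3 := by
      have h20 : R₀ * 1 ≤ R₀ * T := mul_le_mul_of_nonneg_left hT hR₀
      rw [hQ]; linarith
    have hsQ : Real.sqrt Q ≤ Real.sqrt (45 / 2 * R₀) * Real.sqrt T + Real.sqrt (65 * CR) * Real.sqrt (m ^ 3) := by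
      calc Real.sqrt Q ≤ Real.sqrt (45 / 2 * R₀ * T + 65 * CR * m ^ 3) := Real.sqrt_le_sqrt hQle
        _ ≤ Real.sqrt (45 / 2 * R₀ * T) + Real.sqrt (65 * CR * m ^ 3) := sqrt_add_le' (by positivity) (by positivity)
        _ = Real.sqrt (45 / 2 * R₀) * Real.sqrt T + Real.sqrt (65 * CR) * Real.sqrt (m ^ 3) := by
            rw [Real.sqrt_mul (show (0:ℝ) ≤ 45 / 2 * R₀ by positivity) T,
              Real.sqrt_mul (show (0:ℝ) ≤ 65 * CR by positivity) (m ^ 3)]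
    have hKm' : Real.sqrt K ≤ Real.sqrt m := Real.sqrt_le_sqrt hKm
    have hmm : Real.sqrt m * Real.sqrt (m ^ 3) = m ^ 2 := by
      rw [← Real.sqrt_mul hm, show m * m ^ 3 = (m ^ 2) ^ 2 by ring, Real.sqrt_sq (sq_nonneg m)]
    have hTT : Real.sqrt T / T = 1 / Real.sqrt T := by
      have hsT : 0 < Real.sqrt T := Real.sqrt_pos.mpr hT0
      rw [div_eq_div_iff hT0.ne' hsT.ne', one_mul, Real.mul_self_sqrt hT0.le]
    calc Real.sqrt K * (Real.sqrt (1 / (2 * π)) * (2 * Real.sqrt Q / T))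
        = (Real.sqrt (1 / (2 * π)) * 2) * (Real.sqrt K * Real.sqrt Q) / T := by ring
      _ ≤ 1 * (Real.sqrt m * (Real.sqrt (45 / 2 * R₀) * Real.sqrt T + Real.sqrt (65 * CR) * Real.sqrt (m ^ 3))) / T := by
          gcongr
      _ = Real.sqrt (45 / 2 * R₀) * (Real.sqrt m * (Real.sqrt T / T)) +
            Real.sqrt (65 * CR) * ((Real.sqrt m * Real.sqrt (m ^ 3)) / T) := by ring
      _ = Real.sqrt (45 / 2 * R₀) * (Real.sqrt m / Real.sqrt T) + Real.sqrt (65 * CR) * (m ^ 2 / T) := by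
          rw [hmm, hTT]; ring
  -- combine
  set C : ℝ := C₅ / 2 + CE + Real.sqrt (45 / 2 * R₀) + Real.sqrt (65 * CR) + 1 with hC
  have hC1 : C₅ / 2 ≤ C := by rw [hC]; have := Real.sqrt_nonneg (45 / 2 * R₀); have := Real.sqrt_nonneg (65 * CR); linarith
  have hC2 : CE ≤ C := by rw [hC]; have := Real.sqrt_nonneg (45 / 2 * R₀); have := Real.sqrt_nonneg (65 * CR); linarith
  have hC3 : Real.sqrt (45 / 2 * R₀) ≤ C := by rw [hC]; have := Real.sqrt_nonneg (65 * CR); linarith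
  have hC4 : Real.sqrt (65 * CR) ≤ C := by rw [hC]; have := Real.sqrt_nonneg (45 / 2 * R₀); linarith
  have hx1 : 0 ≤ Real.sqrt (m / α) := Real.sqrt_nonneg _
  have hx2 : 0 ≤ Real.sqrt m / Real.sqrt T := by positivity
  have hx3 : 0 ≤ m ^ 2 / T := by positivity
  calc Real.sqrt K * Real.sqrt ((1 / (2 * π)) * ((sA + sB) ^ 2 + 4 * Q / T ^ 2))
      ≤ Real.sqrt K * (Real.sqrt (1 / (2 * π)) * ((sA + sB) + 2 * Real.sqrt Q / T)) :=
        mul_le_mul_of_nonneg_left h1 hK0'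
    _ = Real.sqrt K * (Real.sqrt (1 / (2 * π)) * sA) + Real.sqrt K * (Real.sqrt (1 / (2 * π)) * sB) +
          Real.sqrt K * (Real.sqrt (1 / (2 * π)) * (2 * Real.sqrt Q / T)) := by ring
    _ ≤ (B * K + C₅ / 2 * B) + CE * Real.sqrt (m / α) +
          (Real.sqrt (45 / 2 * R₀) * (Real.sqrt m / Real.sqrt T) + Real.sqrt (65 * CR) * (m ^ 2 / T)) :=
        add_le_add (add_le_add hT1 hT2) hT3
    _ ≤ B * K + C * (B + Real.sqrt (m / α) + Real.sqrt m / Real.sqrt T + m ^ 2 / T) := by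
        have e1 := mul_le_mul_of_nonneg_right hC1 hB
        have e2 := mul_le_mul_of_nonneg_right hC2 hx1
        have e3 := mul_le_mul_of_nonneg_right hC3 hx2
        have e4 := mul_le_mul_of_nonneg_right hC4 hx3
        linarith

/-! ### (3.8) with the sharp Lemma 3.2: the main estimate -/

set_option maxHeartbeats 400000 in
/-- **Granville–Soundararajan (3.8) + Lemma 3.2, sharp, multiplicative case.**  There is an
absolute `C ≥ 0` such that for every multiplicative `f` with `|f| ≤ 1`, `x ≥ 3` (`N = ⌊x⌋`),
`T ≥ 1`, `0 < α ≤ 1`, `B ≥ 0` with `|F(1+α+iy)| ≤ B` for `|y| ≤ T` (`F = ∑ f̃(n) n^{-s}`),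
`∫_{log 2}^{log x} |A(e^u)| e^{-(1+2α)u} du ≤ B (1 - x^{-2α})/(2α) + C (B + √(m/α) + √m/√T + m²/T)`,
`m = min(log x, 1/α)`, `A(y) = ∑_{n ≤ y} f̃(n) log n`.
[cite: GranvilleSoundararajan2003, (3.8), Lemma 3.2 and the display after (3.14)] -/
theorem exists_inner_integral_le_sharp :
    ∃ C : ℝ, 0 ≤ C ∧ ∀ (f : ArithmeticFunction ℂ), f.IsMultiplicative → (∀ n, ‖f n‖ ≤ 1) →
      ∀ x : ℝ, 3 ≤ x → ∀ T : ℝ, 1 ≤ T → ∀ α : ℝ, 0 < α → α ≤ 1 → ∀ B : ℝ, 0 ≤ B →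
        (∀ y : ℝ, |y| ≤ T → ‖LSeries (smoothCut (⇑f) ⌊x⌋₊) (1 + α + y * I)‖ ≤ B) →
        ∫ u in Set.Ioc (Real.log 2) (Real.log x),
            ‖psum (mulLog (⇑f) ⌊x⌋₊) (Real.exp u)‖ * Real.exp (-((1 + 2 * α) * u)) ≤
          B * ((1 - x ^ (-(2 * α))) / (2 * α)) +
            C * (B + Real.sqrt (min (Real.log x) (1 / α) / α) +
                  Real.sqrt (min (Real.log x) (1 / α)) / Real.sqrt T +
                  (min (Real.log x) (1 / α)) ^ 2 / T) := by
  obtain ⟨C₅, hC₅0, hC₅⟩ := exists_meanSquare_mulVM_le_sharp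
  obtain ⟨C_W, hCW0, hCW⟩ := exists_tsum_mul_norm_term_mulLog_sq_le_log
  set R₀ : ℝ := 16 * ∑' n : ℕ, ((n : ℝ) ^ (3 / 2 : ℝ))⁻¹ with hR₀
  have hR₀0 : 0 ≤ R₀ := mul_nonneg (by norm_num) (tsum_nonneg fun n => by positivity)
  set CE : ℝ := 3 * cmDefectBound with hCEdef
  have hCE0 : 0 ≤ CE := by rw [hCEdef]; unfold cmDefectBound; positivity
  set CR : ℝ := max (4 * Real.exp 10) C_W with hCR
  have hCR0 : 0 ≤ CR := le_trans (by positivity) (le_max_left _ _)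
  refine ⟨C₅ / 2 + CE + Real.sqrt (45 / 2 * R₀) + Real.sqrt (65 * CR) + 1, by positivity, ?_⟩
  intro f hf hfb x hx T hT α hα hα1 B hB0 hB
  set N : ℕ := ⌊x⌋₊ with hN
  set K : ℝ := (1 - x ^ (-(2 * α))) / (2 * α) with hK
  set m : ℝ := min (Real.log x) (1 / α) with hm
  have hx0 : 0 < x := by linarith
  have hx1 : 1 ≤ x := by linarith
  have hT0 : 0 < T := by linarith
  have hlx : 1 ≤ Real.log x := by
    rw [Real.le_log_iff_exp_le hx0]
    exact le_trans (by have := Real.exp_one_lt_d9; linarith) hx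
  have hxpow : x ^ (-(2 * α)) < 1 := Real.rpow_lt_one_of_one_lt_of_neg (by linarith) (by linarith)
  have hxpow0 : 0 < x ^ (-(2 * α)) := Real.rpow_pos_of_pos hx0 _
  have hK0 : 0 ≤ K := by rw [hK]; exact div_nonneg (by linarith) (by linarith)
  have hm0 : 0 ≤ m := le_min (by linarith) (by positivity)
  have hKm : K ≤ m := by
    refine le_min ?_ ?_
    · -- `1 - x^{-2α} ≤ 2α log x`
      rw [hK, div_le_iff₀ (by positivity)]
      have h := Real.add_one_le_exp (Real.log x * (-(2 * α)))
      rw [← Real.rpow_def_of_pos hx0] at h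
      nlinarith
    · rw [hK, div_le_div_iff₀ (by positivity) hα]; nlinarith
  -- the completely multiplicative part
  have hgb : ∀ n, ‖cmLift f n‖ ≤ 1 := norm_cmLift_le_one f (fun p _ => hfb p)
  -- coefficient data for the tails
  obtain ⟨hs₀, hR₀le⟩ := tsum_norm_term_mulLog_sq_le (g := ⇑f) (N := N) hfb hα
  obtain ⟨hs₁, hR₁a⟩ := Halasz.tsum_mul_norm_term_mulLog_sq_le (g := ⇑f) (N := N) hfb hα hα1
  have hR₁b := hCW (⇑f) hfb x hx α hα
  have hR₁ : ∑' n : ℕ, (n : ℝ) * ‖LSeries.term (mulLog (⇑f) N) (1 + α) n‖ ^ 2 ≤ CR * m ^ 3 := by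
    rcases le_total (Real.log x) (1 / α) with h | h
    · rw [hm, min_eq_left h]
      exact hR₁b.trans (mul_le_mul_of_nonneg_right (le_max_right _ _) (by positivity))
    · rw [hm, min_eq_right h]
      calc _ ≤ 4 * Real.exp 10 / α ^ 3 := hR₁a
        _ = 4 * Real.exp 10 * (1 / α) ^ 3 := by field_simp
        _ ≤ CR * (1 / α) ^ 3 := mul_le_mul_of_nonneg_right (le_max_left _ _) (by positivity)
  set Q : ℝ := (5 * (T / 2) + 20) * R₀ + 65 * (CR * m ^ 3) with hQ
  have hQ0 : 0 ≤ Q := by positivity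
  have htailR := setIntegral_Ioi_tail_le_T (N := N) hfb hα hT0 hR₀le hs₁ hR₁
  have htailL := setIntegral_Iio_tail_le_T (N := N) hfb hα hT0 hR₀le hs₁ hR₁
  -- the window
  have hIP : ∫ y : ℝ, ‖LSeries (mulVM (⇑(cmLift f)) N) (1 + α + y * I)‖ ^ 2 / ‖(1 : ℂ) + α + y * I‖ ^ 2 ≤
      2 * π * (K + C₅) := by
    have h1 := Halasz.meanSquare_mulVM_eq (g := ⇑(cmLift f)) (N := N) hgb hα
    have h2 := hC₅ (⇑(cmLift f)) hgb x hx α hα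
    rw [h1] at h2
    have hπ : 0 < 2 * π := by positivity
    calc ∫ y : ℝ, ‖LSeries (mulVM (⇑(cmLift f)) N) (1 + α + y * I)‖ ^ 2 / ‖(1 : ℂ) + α + y * I‖ ^ 2
        = 2 * π * (1 / (2 * π) * ∫ y : ℝ, ‖LSeries (mulVM (⇑(cmLift f)) N) (1 + α + y * I)‖ ^ 2 /
            ‖(1 : ℂ) + α + y * I‖ ^ 2) := by rw [← mul_assoc, mul_one_div_cancel hπ.ne', one_mul]
      _ ≤ 2 * π * (K + C₅) := by gcongr
  have hIG := integral_normSq_smoothCut_div_le (N := N) hgb hα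
  set 𝔄 : ℝ := B ^ 2 * (2 * π * (K + C₅)) with h𝔄
  set 𝔅 : ℝ := CE ^ 2 * (π / α) with h𝔅
  have h𝔄0 : 0 ≤ 𝔄 := by positivity
  have h𝔅0 : 0 ≤ 𝔅 := by positivity
  have hwin : ∫ y in Set.Icc (-T) T, ‖LSeries (mulLog (⇑f) N) (1 + α + y * I)‖ ^ 2 / ‖(1 : ℂ) + α + y * I‖ ^ 2 ≤
      (Real.sqrt 𝔄 + Real.sqrt 𝔅) ^ 2 := by
    refine le_sq_sqrt_add_of_forall_eps h𝔄0 h𝔅0 fun ε hε => ?_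
    refine (setIntegral_window_le_eps f hf hfb N hα hB hε).trans ?_
    have hε1 : 0 ≤ 1 + ε⁻¹ := by positivity
    have e1 : (1 + ε) * B ^ 2 * (∫ y : ℝ, ‖LSeries (mulVM (⇑(cmLift f)) N) (1 + α + y * I)‖ ^ 2 /
        ‖(1 : ℂ) + α + y * I‖ ^ 2) ≤ (1 + ε) * 𝔄 := by
      rw [h𝔄, ← mul_assoc]
      exact mul_le_mul_of_nonneg_left hIP (by positivity)
    have e2 : (1 + ε⁻¹) * (3 * cmDefectBound) ^ 2 *
        (∫ y : ℝ, ‖LSeries (smoothCut (⇑(cmLift f)) N) (1 + α + y * I)‖ ^ 2 / ‖(1 : ℂ) + α + y * I‖ ^ 2) ≤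
        (1 + ε⁻¹) * 𝔅 := by
      rw [h𝔅, hCEdef, ← mul_assoc]
      exact mul_le_mul_of_nonneg_left hIG (by positivity)
    linarith
  -- the whole line
  have hJ : ∫ y : ℝ, ‖LSeries (mulLog (⇑f) N) (1 + α + y * I)‖ ^ 2 / ‖(1 : ℂ) + α + y * I‖ ^ 2 ≤
      (Real.sqrt 𝔄 + Real.sqrt 𝔅) ^ 2 + 4 * Q / T ^ 2 := by
    have h := Halasz.integral_le_window_add_tails (g := ⇑f) (N := N) hfb hα hT0.le
    have : 2 * ((5 * (T / 2) + 20) * R₀ + 65 * (CR * m ^ 3)) / T ^ 2 = 2 * Q / T ^ 2 := by rw [hQ]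
    rw [this] at htailR htailL
    have h4 : 2 * Q / T ^ 2 + 2 * Q / T ^ 2 = 4 * Q / T ^ 2 := by ring
    linarith
  -- the `u`-side mean square
  have hJu : ∫ u : ℝ, ‖psum (mulLog (⇑f) N) (Real.exp u)‖ ^ 2 * Real.exp (-(2 * (1 + α) * u)) ≤
      (1 / (2 * π)) * ((Real.sqrt 𝔄 + Real.sqrt 𝔅) ^ 2 + 4 * Q / T ^ 2) := by
    rw [Halasz.meanSquare_mulLog_eq (g := ⇑f) (N := N) hfb hα]
    exact mul_le_mul_of_nonneg_left hJ (by positivity)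
  set Jb : ℝ := (1 / (2 * π)) * ((Real.sqrt 𝔄 + Real.sqrt 𝔅) ^ 2 + 4 * Q / T ^ 2) with hJb
  have hJb0 : 0 ≤ Jb := by positivity
  -- Cauchy–Schwarz in `u`
  set μ : Measure ℝ := volume.restrict (Set.Ioc (Real.log 2) (Real.log x)) with hμ
  set fu : ℝ → ℝ := fun u => ‖psum (mulLog (⇑f) N) (Real.exp u)‖ * Real.exp (-((1 + α) * u)) with hfu
  set hh : ℝ → ℝ := fun u => Real.exp (-(α * u)) with hhh
  have hfh : ∀ u, ‖psum (mulLog (⇑f) N) (Real.exp u)‖ * Real.exp (-((1 + 2 * α) * u)) = fu u * hh u := by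
    intro u
    simp only [hfu, hhh]
    rw [mul_assoc, ← Real.exp_add]
    congr 2
    ring
  simp_rw [hfh]
  have hfmeas : AEStronglyMeasurable fu μ := by
    refine (Measurable.aestronglyMeasurable ?_)
    exact (((MellinPlancherel.measurable_psum _).comp Real.measurable_exp).norm).mul
      (Real.measurable_exp.comp (by fun_prop))
  have hhmeas : AEStronglyMeasurable hh μ := (by fun_prop : Continuous hh).aestronglyMeasurable
  have hlog2 : 0 < Real.log 2 := Real.log_pos (by norm_num)
  have hfbd : ∀ᵐ u ∂μ, ‖fu u‖ ≤ x * Real.log x := by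
    refine ae_restrict_of_forall_mem measurableSet_Ioc fun u hu => ?_
    have h1 := Halasz.kernel_le hfb N hx1 (by positivity : (0:ℝ) ≤ α / 4) (p := (α / 2, u))
      ⟨⟨by simp only; linarith, by simp only; linarith⟩, hu⟩
    simp only at h1
    simp only [hfu]
    convert h1 using 4
    ring
  have hhbd : ∀ᵐ u ∂μ, ‖hh u‖ ≤ 1 := by
    refine ae_restrict_of_forall_mem measurableSet_Ioc fun u hu => ?_
    simp only [hhh, Real.norm_eq_abs, abs_of_pos (Real.exp_pos _), Real.exp_le_one_iff]
    have : 0 < u := hlog2.trans hu.1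
    nlinarith
  have hfmem : MemLp fu (ENNReal.ofReal 2) μ := by
    rw [ENNReal.ofReal_ofNat]; exact MemLp.of_bound hfmeas _ hfbd
  have hhmem : MemLp hh (ENNReal.ofReal 2) μ := by
    rw [ENNReal.ofReal_ofNat]; exact MemLp.of_bound hhmeas _ hhbd
  have hH := integral_mul_le_Lp_mul_Lq_of_nonneg Real.HolderConjugate.two_two
    (Filter.Eventually.of_forall fun u => by positivity)
    (Filter.Eventually.of_forall fun u => (Real.exp_pos _).le) hfmem hhmem
  have hf2 : ∫ u, fu u ^ (2:ℝ) ∂μ ≤ Jb := by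
    simp_rw [Real.rpow_two]
    have hint := Halasz.integrable_meanSquare_integrand (g := ⇑f) hfb N hα
    have heq : ∀ u, fu u ^ 2 = ‖psum (mulLog (⇑f) N) (Real.exp u)‖ ^ 2 * Real.exp (-(2 * (1 + α) * u)) := by
      intro u
      simp only [hfu]
      rw [mul_pow, ← Real.exp_nat_mul]
      congr 2
      push_cast
      ring
    simp_rw [heq]
    exact (setIntegral_le_integral hint (Filter.Eventually.of_forall fun u => by positivity)).trans hJu
  have hh2 : ∫ u, hh u ^ (2:ℝ) ∂μ ≤ K := by
    simp_rw [Real.rpow_two]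
    have heq : ∀ u, hh u ^ 2 = Real.exp (-(2 * α) * u) := by
      intro u
      simp only [hhh]
      rw [← Real.exp_nat_mul]
      congr 1
      push_cast
      ring
    simp_rw [heq]
    exact setIntegral_exp_neg_le_K hx hα
  have hf2_0 : 0 ≤ ∫ u, fu u ^ (2:ℝ) ∂μ := integral_nonneg fun u => by positivity
  have hh2_0 : 0 ≤ ∫ u, hh u ^ (2:ℝ) ∂μ := integral_nonneg fun u => by positivity
  have halg := final_algebra (C₅ := C₅) (CE := CE) (R₀ := R₀) (CR := CR) hB0 hK0 hC₅0 hCE0 hα hm0 hKm hT hR₀0 hCR0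
  calc ∫ u, fu u * hh u ∂μ
      ≤ (∫ u, fu u ^ (2:ℝ) ∂μ) ^ (1 / (2:ℝ)) * (∫ u, hh u ^ (2:ℝ) ∂μ) ^ (1 / (2:ℝ)) := hH
    _ ≤ Jb ^ (1 / (2:ℝ)) * K ^ (1 / (2:ℝ)) :=
        mul_le_mul (Real.rpow_le_rpow hf2_0 hf2 (by norm_num)) (Real.rpow_le_rpow hh2_0 hh2 (by norm_num))
          (Real.rpow_nonneg hh2_0 _) (Real.rpow_nonneg hJb0 _)
    _ = Real.sqrt K * Real.sqrt Jb := by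
        rw [Real.sqrt_eq_rpow, Real.sqrt_eq_rpow, mul_comm]
    _ ≤ B * K + (C₅ / 2 + CE + Real.sqrt (45 / 2 * R₀) + Real.sqrt (65 * CR) + 1) *
          (B + Real.sqrt (m / α) + Real.sqrt m / Real.sqrt T + m ^ 2 / T) := by
        rw [hJb, h𝔄, h𝔅, hQ]
        exact halg

end GranvilleSoundararajan

end Literature.NumberTheory.LFunctions
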